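import Literature.NumberTheory.Sieve.HeathBrownCubicGrossenTrivial
import Literature.NumberTheory.Sieve.HeathBrownCubicGrossenSums
import Literature.NumberTheory.LFunctions.LSeriesContinuationOfPartialSums
import HarnessLib

/-!
# The `L`-functions `L(s, ν^{(j,k)})` of Heath-Brown's Grössencharaktere: continuation and growth

With the partial-sum bound `exists_grossenChar_partialSum_bound` (`HeathBrownCubicGrossenSums`:
`∑_{0<N(I)≤x} ν(I)N(I)^{iΘ} = O(q³(1+|j|+|k|) x^{8/9})` for a non-trivial `ν^{(j,k)} mod q`) and the
continuation of Dirichlet series from partial sums (`LSeriesContinuationOfPartialSums`, θ = 8/9), this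
file constructs and studies **`grossenL hq χ j k s = L(s, ν^{(j,k)})`**, the analytic object of
T. Mitsui's prime number theorem with Grössencharakteren (Jap. J. Math. 26 (1956), Lemma 5 =
Lemma 9.4 of D. R. Heath-Brown, *Primes represented by `x³ + 2y³`*, Acta Math. 186 (2001)) —
classically obtained from Hecke's functional equation, here from lattice-point counting.
Everything is PROVED; definitions (`twistedCoeff`, `grossenL`, `sqChar`, `condQ`) have bodies.

* `twistedCoeff hq χ j k n = (∑_{N(I)=n} ν(I)) n^{iΘ}` (`Θ = thetaOf χ j k`), with
  `‖∑_{n≤N} b(n)‖ ≤ C q³(1+|j|+|k|) N^{8/9}` (`exists_sum_twistedCoeff_bound`) and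
  `L(b, s + iΘ) = L(s, ν)` termwise (`LSeries_twistedCoeff`);
* `grossenL hq χ j k s := contF b (s + iΘ)`: **holomorphic on `σ > 8/9`**
  (`differentiableOn_grossenL`), **`= ∑ ν(I)N(I)^{−s}` for `σ > 1`** (`grossenL_eq_LSeries`),
  **`‖L(s,ν)‖ ≤ C q³(1+|j|+|k|) δ⁻¹ (|t+Θ|+4)`** on `8/9 + δ ≤ σ ≤ 3` (`exists_norm_grossenL_le`), for
  every non-trivial `ν^{(j,k)}`, one absolute `C`;
* the square `sqChar ν = ν²` as a homomorphism, `exists_sqChar_grossenChar_eq`: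
  `(ν^{(j,k)})² = ν^{(2j,k'')}` for the character `χ²` and some `|k''| ≤ 2|k|+2|j|+3` (via
  `t_{χ²} ≡ 2t_χ (mod 2π)`, `exists_charAngle_sq`), and the **pole criterion**
  `params_of_isTrivialMod_sq`: `ν²` trivial `mod q` forces `χ² = χ₀`, `j = k = 0`, `t_χ = 0`
  (so `ν` is a real character);
* the fields of the zero-free-region datum `TwistedZFRData` (`TwistedZeroFreeRegion`) that concern
  `L(s, ν)` alone, with the conductor-type size `condQ q j k = q³(|j|+|k|+2)²`
  (`condQ_sq_le : Q(q,2j,k'') ≤ 16 Q(q,j,k)`): non-vanishing and the lower bound `c₁(σ−1)` on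
  `1 < σ ≤ 2` (`grossenL_ne_zero`, `exists_grossenL_lower`, from `TwistedDedekindCoefficients`),
  `L'/L = −L(Λ_ν)` (`logDeriv_grossenL`), and the growth `‖L(s,ν)‖ ≤ C_g Q (|t|+4)` on
  `17/18 < σ ≤ 3` (`exists_grossenL_growth`, `A = 1`).

## References

* T. Mitsui, *Generalized prime number theorem*, Jap. J. Math. 26 (1956), 1–42, Lemma 5. [cite: Mitsui1956, Lemma 5]
* D. R. Heath-Brown, *Primes represented by `x³ + 2y³`*, Acta Math. 186 (2001), §9 (9.2), p. 54–55,
  Lemma 9.4. [cite: HeathBrownActa2001, §9 Lemma 9.4]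
* H. L. Montgomery, R. C. Vaughan, *Multiplicative Number Theory I*, CUP 2007, Theorem 1.3, Lemma 11.1.
  [cite: MontgomeryVaughan2007, Lemma 11.1]

## Mathlib / tree search

Tree: `HeathBrownCubicGrossenSums` (partial sums, `kappaOf`, `thetaOf`, `normPhase`, `normTwist`,
`nuO_eq_charW`, `canonGen`), `HeathBrownCubicGrossenTrivial` (`isTrivialMod_iff`), `HeathBrownCubicGrossen`
(`mulChar_unitGen_eq`, `abs_charAngle_le`, `charAngle_one`, `norm_grossenChar_le`),
`LSeriesContinuationOfPartialSums` (`contF`, `differentiableOn_contF`, `contF_eq_LSeries`,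
`norm_contF_le_of_le`), `TwistedDedekindCoefficients` (`twistCount`, `twistVonMangoldt`,
`LSeriesSummable_twistCount`, `LSeries_twistCount_ne_zero`, `logDeriv_LSeries_twistCount`,
`exists_norm_LSeries_twistCount_ge`, `map_bot`). Mathlib: `Complex.cpow_def_of_ne_zero`,
`Complex.exp_eq_exp_iff_exists_int`, `MulChar.pow_apply'`, `Filter.EventuallyEq.deriv_eq`,
`Int.abs_lt_one_iff`. No Hecke/Grössencharakter `L`-function in Mathlib.
-/

noncomputable section

open NumberField Finset Complex Set
open scoped Pointwise

namespace Literature.NumberTheory.Sieve.CubicSieve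

open LFunctions.CubeRootTwoField CubicPrimes

variable {q : ℕ}
/-! ## The twisted coefficients and the continued `L(s, ν)` -/

section LFunction

open LFunctions LFunctions.NumberField LFunctions.PartialSumContinuation

/-- **The twisted coefficients** `b(n) = (∑_{N(I)=n} ν(I)) · n^{iΘ}` of `L(s − iΘ, ν)`.
[cite: HeathBrownActa2001, §9 (9.2)] -/
def twistedCoeff (hq : 1 ≤ q) (χ : MulChar (QuotMod q) ℂ) (j k : ℤ) (n : ℕ) : ℂ :=
  twistCount K (grossenChar hq χ j k) n * normPhase (thetaOf χ j k) n

/-- Partial sums of the twisted coefficients are the untwisted ideal sums. [folklore] -/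
theorem sum_Icc_twistedCoeff_eq (hq : 1 ≤ q) (χ : MulChar (QuotMod q) ℂ) (j k : ℤ) (N : ℕ) :
    ∑ n ∈ Finset.Icc 1 N, twistedCoeff hq χ j k n =
      ∑ I ∈ idealsUpTo N, grossenChar hq χ j k I * normPhase (thetaOf χ j k) (Ideal.absNorm I) := by
  rw [sum_idealsUpTo_eq]
  refine Finset.sum_congr rfl fun n _ ↦ ?_
  rw [twistedCoeff, twistCount, Finset.sum_mul]
  refine Finset.sum_congr rfl fun I hI ↦ ?_
  rw [mem_idealsOfNorm] at hI
  rw [hI]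

/-- `|b(n)| ≤ #{I : N(I) = n}` (the ideal-counting majorant). [folklore] -/
theorem norm_twistedCoeff_le (hq : 1 ≤ q) (χ : MulChar (QuotMod q) ℂ) (j k : ℤ) (n : ℕ) :
    ‖twistedCoeff hq χ j k n‖ ≤ idealNormCount K n := by
  rw [twistedCoeff, norm_mul, norm_normPhase, mul_one]
  exact norm_twistCount_le (norm_grossenChar_le hq χ j k) n

/-- **Partial sums of the twisted coefficients of a non-trivial `ν^{(j,k)}`**:
`‖∑_{n ≤ N} b(n)‖ ≤ C q³ (1+|j|+|k|) N^{8/9}`. [cite: HeathBrownActa2001, §9 Lemma 9.4 (input)] -/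
theorem exists_sum_twistedCoeff_bound :
    ∃ C : ℝ, 0 ≤ C ∧ ∀ (q : ℕ) (hq : 1 ≤ q) (χ : MulChar (QuotMod q) ℂ) (j k : ℤ),
      ¬ IsTrivialMod q (grossenChar hq χ j k) → ∀ N : ℕ, 1 ≤ N →
        ‖∑ n ∈ Finset.Icc 1 N, twistedCoeff hq χ j k n‖ ≤
          C * (q : ℝ) ^ 3 * (1 + |(j : ℝ)| + |(k : ℝ)|) * (N : ℝ) ^ (8 / 9 : ℝ) := by
  obtain ⟨C, hC⟩ := exists_grossenChar_partialSum_bound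
  refine ⟨max C 0, le_max_right _ _, fun q hq χ j k hν N hN ↦ ?_⟩
  have hN0 : (0 : ℝ) < N := by exact_mod_cast hN
  set t : ℝ := (N : ℝ) ^ ((1 : ℝ) / 3) with ht
  have ht1 : 1 ≤ t := Real.one_le_rpow (by exact_mod_cast hN) (by norm_num)
  have ht3 : t ^ 3 = N := by
    rw [ht, ← Real.rpow_natCast, ← Real.rpow_mul hN0.le]; norm_num
  have hfloor : ⌊t ^ 3⌋₊ = N := by rw [ht3, Nat.floor_natCast]
  have ht83 : t ^ (8 / 3 : ℝ) = (N : ℝ) ^ (8 / 9 : ℝ) := by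
    rw [ht, ← Real.rpow_mul hN0.le]; norm_num
  have h := hC q hq χ j k hν t ht1
  rw [hfloor, ht83] at h
  rw [sum_Icc_twistedCoeff_eq]
  refine h.trans ?_
  gcongr
  exact le_max_left _ _

/-- `|Θ| ≤ 2π(|k|+|j|+1)/(3 log ε)`. [folklore] -/
theorem abs_thetaOf_le (χ : MulChar (QuotMod q) ℂ) (j k : ℤ) :
    |thetaOf χ j k| ≤ 2 * Real.pi / (3 * unitLog) * (|(k : ℝ)| + |(j : ℝ)| + 1) := by
  have hv := unitLog_pos
  rw [thetaOf, show 2 * Real.pi * kappaOf χ j k / (3 * unitLog) =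
    2 * Real.pi / (3 * unitLog) * kappaOf χ j k by ring, abs_mul,
    abs_of_pos (by positivity : 0 < 2 * Real.pi / (3 * unitLog))]
  exact mul_le_mul_of_nonneg_left (abs_kappaOf_le χ j k) (by positivity)

/-- **The continued `L`-function** `L(s, ν^{(j,k)})`: `contF` of the twisted coefficients, shifted by
`iΘ` (`= ∑ ν(I)N(I)^{-s}` for `σ > 1`, holomorphic on `σ > 8/9`). [cite: Mitsui1956, Lemma 5] -/
def grossenL (hq : 1 ≤ q) (χ : MulChar (QuotMod q) ℂ) (j k : ℤ) (s : ℂ) : ℂ :=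
  contF (twistedCoeff hq χ j k) (s + thetaOf χ j k * I)

/-- `n^{iΘ} · n^{−(s+iΘ)} = n^{−s}` for `n ≥ 1`. [folklore] -/
theorem normPhase_mul_cpow (Θ : ℝ) {n : ℕ} (hn : n ≠ 0) (s : ℂ) :
    normPhase Θ n * (n : ℂ) ^ (-(s + Θ * I)) = (n : ℂ) ^ (-s) := by
  have hn' : (n : ℂ) ≠ 0 := by exact_mod_cast hn
  rw [normPhase, Complex.cpow_def_of_ne_zero hn', Complex.cpow_def_of_ne_zero hn', ← Complex.exp_add]
  congr 1
  rw [← Complex.ofReal_natCast, ← Complex.ofReal_log (Nat.cast_nonneg n)]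
  push_cast
  ring

/-- The terms of `L(b, s + iΘ)` are those of `L(a, s)`, `a = twistCount ν`. [folklore] -/
theorem term_twistedCoeff (hq : 1 ≤ q) (χ : MulChar (QuotMod q) ℂ) (j k : ℤ) (s : ℂ) (n : ℕ) :
    LSeries.term (twistedCoeff hq χ j k) (s + thetaOf χ j k * I) n =
      LSeries.term (twistCount K (grossenChar hq χ j k)) s n := by
  rcases eq_or_ne n 0 with rfl | hn
  · simp
  rw [LSeries.term_of_ne_zero hn, LSeries.term_of_ne_zero hn, twistedCoeff, div_eq_mul_inv,
    div_eq_mul_inv, ← Complex.cpow_neg, ← Complex.cpow_neg, mul_assoc, normPhase_mul_cpow _ hn]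

/-- **`L(b, s + iΘ) = L(s, ν)`** as `L`-series. [folklore] -/
theorem LSeries_twistedCoeff (hq : 1 ≤ q) (χ : MulChar (QuotMod q) ℂ) (j k : ℤ) (s : ℂ) :
    LSeries (twistedCoeff hq χ j k) (s + thetaOf χ j k * I) =
      LSeries (twistCount K (grossenChar hq χ j k)) s := by
  rw [LSeries, LSeries]
  exact tsum_congr fun n ↦ term_twistedCoeff hq χ j k s n

/-- `L(b, ·)` converges absolutely at `s + iΘ` for `Re s > 1`. [folklore] -/
theorem LSeriesSummable_twistedCoeff (hq : 1 ≤ q) (χ : MulChar (QuotMod q) ℂ) (j k : ℤ) {s : ℂ}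
    (hs : 1 < s.re) : LSeriesSummable (twistedCoeff hq χ j k) (s + thetaOf χ j k * I) := by
  have h := LSeriesSummable_twistCount (K := K) (norm_grossenChar_le hq χ j k) hs
  rw [LSeriesSummable] at h ⊢
  refine h.congr fun n ↦ ?_
  rw [term_twistedCoeff]

/-- `0 ≤ 8/9`. [folklore] -/
theorem eight_ninths_nonneg : (0 : ℝ) ≤ 8 / 9 := by norm_num

/-- **`L(s, ν)` is holomorphic on `σ > 8/9`** for a non-trivial `ν^{(j,k)}`. [cite: Mitsui1956, Lemma 5] -/
theorem differentiableOn_grossenL (hq : 1 ≤ q) (χ : MulChar (QuotMod q) ℂ) (j k : ℤ)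
    (hν : ¬ IsTrivialMod q (grossenChar hq χ j k)) :
    DifferentiableOn ℂ (grossenL hq χ j k) {s : ℂ | 8 / 9 < s.re} := by
  obtain ⟨C, -, hC⟩ := exists_sum_twistedCoeff_bound
  have hA := hC q hq χ j k hν
  have hd := differentiableOn_contF eight_ninths_nonneg hA
  intro s hs
  have hs' : s + thetaOf χ j k * I ∈ {s : ℂ | 8 / 9 < s.re} := by simpa using hs
  have h1 : DifferentiableAt ℂ (contF (twistedCoeff hq χ j k)) (s + thetaOf χ j k * I) :=
    (hd _ hs').differentiableAt ((isOpen_lt continuous_const Complex.continuous_re).mem_nhds hs')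
  have h2 : DifferentiableAt ℂ (fun z : ℂ ↦ z + thetaOf χ j k * I) s :=
    differentiableAt_id.add (differentiableAt_const _)
  exact (h1.comp s h2).differentiableWithinAt

/-- **`L(s, ν) = ∑ ν(I) N(I)^{−s}` for `σ > 1`.** [cite: Mitsui1956, Lemma 5] -/
theorem grossenL_eq_LSeries (hq : 1 ≤ q) (χ : MulChar (QuotMod q) ℂ) (j k : ℤ)
    (hν : ¬ IsTrivialMod q (grossenChar hq χ j k)) {s : ℂ} (hs : 1 < s.re) :
    grossenL hq χ j k s = LSeries (twistCount K (grossenChar hq χ j k)) s := by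
  obtain ⟨C, -, hC⟩ := exists_sum_twistedCoeff_bound
  have hA := hC q hq χ j k hν
  rw [grossenL, contF_eq_LSeries eight_ninths_nonneg hA (by norm_num) (by simpa using hs)
    (LSeriesSummable_twistedCoeff hq χ j k hs), LSeries_twistedCoeff]

/-- **Polynomial growth of `L(s, ν)` in the strip** `8/9 + δ ≤ σ ≤ 3`, uniformly:
`‖L(s, ν)‖ ≤ C q³(1+|j|+|k|) δ⁻¹ (|t + Θ| + 4)`, one absolute `C` for all non-trivial `ν^{(j,k)}`.
[cite: Mitsui1956, Lemma 5] -/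
theorem exists_norm_grossenL_le :
    ∃ C : ℝ, 0 ≤ C ∧ ∀ (q : ℕ) (hq : 1 ≤ q) (χ : MulChar (QuotMod q) ℂ) (j k : ℤ),
      ¬ IsTrivialMod q (grossenChar hq χ j k) → ∀ {δ : ℝ}, 0 < δ → ∀ {s : ℂ}, 8 / 9 + δ ≤ s.re → s.re ≤ 3 →
        ‖grossenL hq χ j k s‖ ≤
          C * (q : ℝ) ^ 3 * (1 + |(j : ℝ)| + |(k : ℝ)|) / δ * (|s.im + thetaOf χ j k| + 4) := by
  obtain ⟨C, hC0, hC⟩ := exists_sum_twistedCoeff_bound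
  refine ⟨C, hC0, fun q hq χ j k hν δ hδ s hs hs3 ↦ ?_⟩
  have hA := hC q hq χ j k hν
  have h := norm_contF_le_of_le eight_ninths_nonneg hA hδ (s := s + thetaOf χ j k * I)
    (by simpa using hs) (by simpa using hs3)
  rw [grossenL]
  convert h using 2
  simp

end LFunction

/-! ## The square character `ν²` and the pole criterion -/

section Square

/-- **The pointwise square** of an ideal character, again a homomorphism `Ideal(𝓞_K) →*₀ ℂ`. [folklore] -/
def sqChar (ν : Ideal (𝓞 K) →*₀ ℂ) : Ideal (𝓞 K) →*₀ ℂ where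
  toFun I := ν I ^ 2
  map_zero' := by show ν 0 ^ 2 = 0; rw [map_zero, zero_pow two_ne_zero]
  map_one' := by show ν 1 ^ 2 = 1; rw [map_one, one_pow]
  map_mul' I J := by show ν (I * J) ^ 2 = ν I ^ 2 * ν J ^ 2; rw [map_mul, mul_pow]

/-- Values of the square character. [folklore] -/
@[simp] theorem sqChar_apply (ν : Ideal (𝓞 K) →*₀ ℂ) (I : Ideal (𝓞 K)) : sqChar ν I = ν I ^ 2 := rfl

/-- `|ν²| ≤ 1` when `|ν| ≤ 1`. [folklore] -/
theorem norm_sqChar_le {ν : Ideal (𝓞 K) →*₀ ℂ} (hν : ∀ I, ‖ν I‖ ≤ 1) (I : Ideal (𝓞 K)) :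
    ‖sqChar ν I‖ ≤ 1 := by
  rw [sqChar_apply, norm_pow]; exact pow_le_one₀ (norm_nonneg _) (hν I)

/-- **`t_{χ²} ≡ 2 t_χ (mod 2π)`**: `charAngle (χ²) = 2 charAngle χ + 2πm` for some `m ∈ ℤ`
(both are arguments of `χ(ε)² = e^{2it_χ}`). [folklore] -/
theorem exists_charAngle_sq (hq : 1 ≤ q) (χ : MulChar (QuotMod q) ℂ) :
    ∃ m : ℤ, charAngle (χ ^ 2) = 2 * charAngle χ + 2 * Real.pi * m := by
  have h1 := mulChar_unitGen_eq hq (χ ^ 2)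
  have h2 := mulChar_unitGen_eq hq χ
  rw [MulChar.pow_apply' χ two_ne_zero, h2, ← Complex.exp_nat_mul] at h1
  obtain ⟨m, hm⟩ := Complex.exp_eq_exp_iff_exists_int.1 h1
  refine ⟨-m, ?_⟩
  have := congrArg Complex.im hm
  simp at this
  push_cast
  linarith

/-- `ψ_{j,κ}² = ψ_{2j,2κ}`. [folklore] -/
theorem charW_sq (j : ℤ) (κ : ℝ) (w : ℝ × ℂ) : charW j κ w ^ 2 = charW (2 * j) (2 * κ) w := by
  rw [charW, charW, mul_pow, ← Complex.exp_nat_mul, ← Complex.exp_nat_mul]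
  congr 2 <;> push_cast <;> ring

/-- `(N^{−iΘ(κ)})² = N^{−iΘ(2κ)}`. [folklore] -/
theorem normTwist_sq (κ : ℝ) (w : ℝ × ℂ) : normTwist κ w ^ 2 = normTwist (2 * κ) w := by
  rw [normTwist, normTwist, ← Complex.exp_nat_mul]
  congr 1; push_cast; ring

/-- **`(ν^{(j,k)})² = ν^{(2j,k'')}` with the character `χ²`** for a suitable `k'' ∈ ℤ`
(`k'' = 2k − m`, `m` from `exists_charAngle_sq`, so that `κ'' = 2κ`). [cite: HeathBrownActa2001, §9 p. 54] -/
theorem exists_sqChar_grossenChar_eq (hq : 1 ≤ q) (χ : MulChar (QuotMod q) ℂ) (j k : ℤ) :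
    ∃ k'' : ℤ, |k''| ≤ 2 * |k| + 2 * |j| + 3 ∧ kappaOf (χ ^ 2) (2 * j) k'' = 2 * kappaOf χ j k ∧
      sqChar (grossenChar hq χ j k) = grossenChar hq (χ ^ 2) (2 * j) k'' := by
  obtain ⟨m, hm⟩ := exists_charAngle_sq hq χ
  have hπ := Real.pi_pos
  -- size of `m`: `|2πm| = |t₂ − 2t| ≤ 3π`
  have hmb : |(m : ℝ)| ≤ 2 := by
    have h1 := abs_charAngle_le (χ ^ 2)
    have h2 := abs_charAngle_le χ
    have : |2 * Real.pi * m| ≤ 3 * Real.pi := by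
      rw [show 2 * Real.pi * (m : ℝ) = charAngle (χ ^ 2) - 2 * charAngle χ by linarith]
      calc |charAngle (χ ^ 2) - 2 * charAngle χ| ≤ |charAngle (χ ^ 2)| + |2 * charAngle χ| := abs_sub _ _
        _ = |charAngle (χ ^ 2)| + 2 * |charAngle χ| := by rw [abs_mul, abs_two]
        _ ≤ Real.pi + 2 * Real.pi := by gcongr
        _ = 3 * Real.pi := by ring
    rw [abs_mul, abs_of_pos (by positivity : 0 < 2 * Real.pi)] at this
    nlinarith
  refine ⟨2 * k - m, ?_, ?_, ?_⟩
  · have : |((2 * k - m : ℤ) : ℝ)| ≤ 2 * |(k : ℝ)| + 2 := by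
      push_cast
      calc |2 * (k : ℝ) - m| ≤ |2 * (k : ℝ)| + |(m : ℝ)| := abs_sub _ _
        _ ≤ 2 * |(k : ℝ)| + 2 := by rw [abs_mul, abs_two]; linarith
    have h' : ((|2 * k - m| : ℤ) : ℝ) ≤ ((2 * |k| + 2 * |j| + 3 : ℤ) : ℝ) := by
      push_cast
      rw [← Int.cast_abs] at this ⊢
      push_cast at this ⊢
      linarith [abs_nonneg (j : ℝ)]
    exact_mod_cast h'
  · rw [kappaOf, kappaOf, hm]
    push_cast
    field_simp
    ring
  · -- equality of the two homomorphisms on every ideal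
    have hκ : kappaOf (χ ^ 2) (2 * j) (2 * k - m) = 2 * kappaOf χ j k := by
      rw [kappaOf, kappaOf, hm]; push_cast; field_simp; ring
    ext I
    by_cases hI : I = ⊥
    · rw [hI, LFunctions.NumberField.map_bot, LFunctions.NumberField.map_bot]
    -- a positive generator
    have hgen := span_canonGen I
    have hβ := canonGen_ne_zero hI
    have hell : 0 < ellO (canonGen I) := (canonT_pos hI).trans (inWindow_canonGen hI).1
    rw [← hgen, sqChar_apply, grossenChar_span hq χ j k hβ, grossenChar_span hq (χ ^ 2) (2 * j) (2 * k - m) hβ,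
      ← nuO, ← nuO, nuO_eq_charW χ j k hell, nuO_eq_charW (χ ^ 2) (2 * j) (2 * k - m) hell, hκ,
      MulChar.pow_apply' χ two_ne_zero, mul_pow, mul_pow, charW_sq, normTwist_sq]

/-- **The pole criterion**: if `(ν^{(j,k)})²` is trivial `mod q` then `χ² = χ₀`, `j = 0`, `k = 0` and
`t_χ = 0` — so `ν = ν₀` is a real character (`χ` real with `χ(ε) = 1`). [cite: HeathBrownActa2001, §9 p. 55] -/
theorem params_of_isTrivialMod_sq (hq : 1 ≤ q) {χ : MulChar (QuotMod q) ℂ} {j k : ℤ}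
    (h : IsTrivialMod q (sqChar (grossenChar hq χ j k))) :
    χ ^ 2 = 1 ∧ j = 0 ∧ k = 0 ∧ charAngle χ = 0 := by
  obtain ⟨k'', -, hκ, hsq⟩ := exists_sqChar_grossenChar_eq hq χ j k
  rw [hsq, isTrivialMod_iff hq] at h
  obtain ⟨hχ2, hj, hk''⟩ := h
  have hj0 : j = 0 := by omega
  -- `κ'' = k'' + (0 + t_{χ²})/2π = 0 + 0` since `χ² = 1`; so `2κ = 0`, `κ = k + t/2π = 0`
  have hκ0 : kappaOf χ j k = 0 := by
    have : kappaOf (χ ^ 2) (2 * j) k'' = 0 := by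
      rw [kappaOf, hχ2, charAngle_one, hk'', hj0]; simp
    linarith
  rw [kappaOf, hj0] at hκ0
  simp only [Int.cast_zero, zero_mul, zero_add] at hκ0
  -- `k + t/(2π) = 0` with `|t| ≤ π` and `k ∈ ℤ` forces `k = 0`, `t = 0`… unless `t = ±π`? `|t/2π| ≤ 1/2`,
  -- and `t = arg ∈ (−π, π]`, so `t/2π ∈ (−1/2, 1/2]`; `k = −t/2π ∈ [−1/2, 1/2)` gives `k = 0`.
  have hπ := Real.pi_pos
  have ht := abs_charAngle_le χ
  have htgt : -Real.pi < charAngle χ := (Complex.arg_mem_Ioc _).1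
  have hk0 : k = 0 := by
    have h1 : (k : ℝ) = -(charAngle χ / (2 * Real.pi)) := by linarith
    have h2 : |(k : ℝ)| < 1 := by
      rw [h1, abs_neg, abs_div, abs_of_pos (by positivity : 0 < 2 * Real.pi), div_lt_one (by positivity)]
      linarith
    have h3 : |k| < 1 := by
      rw [← Int.cast_abs] at h2
      exact_mod_cast h2
    exact Int.abs_lt_one_iff.1 h3
  refine ⟨hχ2, hj0, hk0, ?_⟩
  rw [hk0, Int.cast_zero, zero_add, div_eq_zero_iff] at hκ0
  rcases hκ0 with h0 | h0
  · exact h0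
  · linarith

end Square

/-! ## The fields of the zero-free-region datum for `L(s, ν)` -/

section ZFRFields

open LFunctions LFunctions.NumberField LFunctions.PartialSumContinuation Filter Topology

/-- **The conductor-type size** `Q(q, j, k) = q³ (|j| + |k| + 2)²` controlling all constants.
[cite: HeathBrownActa2001, §9 Lemma 9.4] -/
def condQ (q : ℕ) (j k : ℤ) : ℝ := (q : ℝ) ^ 3 * (|(j : ℝ)| + |(k : ℝ)| + 2) ^ 2

/-- `Q ≥ 1` (`q ≥ 1`). [folklore] -/
theorem one_le_condQ {q : ℕ} (hq : 1 ≤ q) (j k : ℤ) : 1 ≤ condQ q j k := by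
  have hq' : (1 : ℝ) ≤ q := by exact_mod_cast hq
  have h1 : (1 : ℝ) ≤ (q : ℝ) ^ 3 := one_le_pow₀ hq'
  have h2 : (1 : ℝ) ≤ (|(j : ℝ)| + |(k : ℝ)| + 2) ^ 2 := by nlinarith [abs_nonneg (j : ℝ), abs_nonneg (k : ℝ)]
  rw [condQ]; nlinarith

/-- The companion parameters have comparable size: `Q(q, 2j, k'') ≤ 16 Q(q, j, k)` when
`|k''| ≤ 2|k| + 2|j| + 3`. [folklore] -/
theorem condQ_sq_le {q : ℕ} (j k k'' : ℤ) (hk'' : |k''| ≤ 2 * |k| + 2 * |j| + 3) :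
    condQ q (2 * j) k'' ≤ 16 * condQ q j k := by
  have h : |((k'' : ℤ) : ℝ)| ≤ 2 * |(k : ℝ)| + 2 * |(j : ℝ)| + 3 := by
    have : ((|k''| : ℤ) : ℝ) ≤ ((2 * |k| + 2 * |j| + 3 : ℤ) : ℝ) := by exact_mod_cast hk''
    push_cast at this
    exact this
  rw [condQ, condQ]
  have hq : (0 : ℝ) ≤ (q : ℝ) ^ 3 := by positivity
  have hj := abs_nonneg (j : ℝ)
  have hk := abs_nonneg (k : ℝ)
  have h2 : |((2 * j : ℤ) : ℝ)| = 2 * |(j : ℝ)| := by push_cast; rw [abs_mul, abs_two]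
  rw [h2]
  have h3 : (2 * |(j : ℝ)| + |((k'' : ℤ) : ℝ)| + 2) ^ 2 ≤ 16 * (|(j : ℝ)| + |(k : ℝ)| + 2) ^ 2 := by
    have h4 : 2 * |(j : ℝ)| + |((k'' : ℤ) : ℝ)| + 2 ≤ 4 * (|(j : ℝ)| + |(k : ℝ)| + 2) := by
      linarith
    have h5 : 0 ≤ 2 * |(j : ℝ)| + |((k'' : ℤ) : ℝ)| + 2 := by positivity
    nlinarith
  nlinarith

/-- **`L(s, ν) ≠ 0` for `σ > 1`.** [folklore] -/
theorem grossenL_ne_zero (hq : 1 ≤ q) (χ : MulChar (QuotMod q) ℂ) (j k : ℤ)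
    (hν : ¬ IsTrivialMod q (grossenChar hq χ j k)) {s : ℂ} (hs : 1 < s.re) : grossenL hq χ j k s ≠ 0 := by
  rw [grossenL_eq_LSeries hq χ j k hν hs]
  exact LSeriesSummable_twistCount (K := K) (norm_grossenChar_le hq χ j k) hs |> fun _ ↦
    LSeries_twistCount_ne_zero (norm_grossenChar_le hq χ j k) hs

/-- **The lower bound** `c₁(σ − 1) ≤ |L(s, ν)|` for `1 < σ ≤ 2`, `c₁ > 0` depending on `K` only.
[cite: MontgomeryVaughan2007, Lemma 11.1 (proof)] -/
theorem exists_grossenL_lower :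
    ∃ c₁ : ℝ, 0 < c₁ ∧ ∀ (q : ℕ) (hq : 1 ≤ q) (χ : MulChar (QuotMod q) ℂ) (j k : ℤ),
      ¬ IsTrivialMod q (grossenChar hq χ j k) → ∀ s : ℂ, 1 < s.re → s.re ≤ 2 →
        c₁ * (s.re - 1) ≤ ‖grossenL hq χ j k s‖ := by
  obtain ⟨c₁, hc₁, h⟩ := exists_norm_LSeries_twistCount_ge (K := K)
  refine ⟨c₁, hc₁, fun q hq χ j k hν s hs hs2 ↦ ?_⟩
  rw [grossenL_eq_LSeries hq χ j k hν hs]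
  exact h _ (norm_grossenChar_le hq χ j k) s hs hs2

/-- **`L'/L(s, ν) = −∑ Λ_ν(n) n^{−s}` for `σ > 1`** (`Λ_ν = twistVonMangoldt`). [folklore] -/
theorem logDeriv_grossenL (hq : 1 ≤ q) (χ : MulChar (QuotMod q) ℂ) (j k : ℤ)
    (hν : ¬ IsTrivialMod q (grossenChar hq χ j k)) {s : ℂ} (hs : 1 < s.re) :
    deriv (grossenL hq χ j k) s / grossenL hq χ j k s =
      -LSeries (twistVonMangoldt K (grossenChar hq χ j k)) s := by
  have hev : grossenL hq χ j k =ᶠ[𝓝 s] LSeries (twistCount K (grossenChar hq χ j k)) := by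
    have ho : IsOpen {z : ℂ | 1 < z.re} := isOpen_lt continuous_const Complex.continuous_re
    filter_upwards [ho.mem_nhds hs] with z hz
    exact grossenL_eq_LSeries hq χ j k hν hz
  rw [hev.deriv_eq, grossenL_eq_LSeries hq χ j k hν hs]
  exact logDeriv_LSeries_twistCount (norm_grossenChar_le hq χ j k) hs

/-- **Growth with conductor**: one absolute `C_g > 0` with
`‖L(s, ν)‖ ≤ C_g · Q(q,j,k) · (|t| + 4)` for `17/18 < σ ≤ 3` and every non-trivial `ν^{(j,k)}`.
[cite: Mitsui1956, Lemma 5] -/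
theorem exists_grossenL_growth :
    ∃ Cg : ℝ, 0 < Cg ∧ ∀ (q : ℕ) (hq : 1 ≤ q) (χ : MulChar (QuotMod q) ℂ) (j k : ℤ),
      ¬ IsTrivialMod q (grossenChar hq χ j k) → ∀ s : ℂ, 1 - 1 / 18 < s.re → s.re ≤ 3 →
        ‖grossenL hq χ j k s‖ ≤ Cg * condQ q j k * (|s.im| + 4) := by
  obtain ⟨C, hC0, hC⟩ := exists_norm_grossenL_le
  have hv := unitLog_pos
  set D : ℝ := 2 * Real.pi / (3 * unitLog) + 1 with hD
  have hD1 : 1 ≤ D := by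
    have : 0 ≤ 2 * Real.pi / (3 * unitLog) := by positivity
    rw [hD]; linarith
  refine ⟨18 * (C + 1) * D, by positivity, fun q hq χ j k hν s hs hs3 ↦ ?_⟩
  have h := hC q hq χ j k hν (δ := 1 / 18) (by norm_num) (s := s) (by linarith) hs3
  have hΘ := abs_thetaOf_le χ j k
  have hj := abs_nonneg (j : ℝ)
  have hk := abs_nonneg (k : ℝ)
  have hq3 : (1 : ℝ) ≤ (q : ℝ) ^ 3 := one_le_pow₀ (by exact_mod_cast hq)
  -- `|t + Θ| + 4 ≤ (|t| + 4)(1 + |Θ|)` and `1 + |Θ| ≤ D (|j|+|k|+2)`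
  have h1 : |s.im + thetaOf χ j k| + 4 ≤ (|s.im| + 4) * (1 + |thetaOf χ j k|) := by
    have := abs_add_le s.im (thetaOf χ j k)
    nlinarith [abs_nonneg s.im, abs_nonneg (thetaOf χ j k)]
  have h2 : 1 + |thetaOf χ j k| ≤ D * (|(j : ℝ)| + |(k : ℝ)| + 2) := by
    rw [hD]
    have : 0 ≤ 2 * Real.pi / (3 * unitLog) := by positivity
    nlinarith
  refine h.trans ?_
  rw [condQ]
  have h3 : C * (q : ℝ) ^ 3 * (1 + |(j : ℝ)| + |(k : ℝ)|) / (1 / 18) =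
      18 * C * ((q : ℝ) ^ 3 * (1 + |(j : ℝ)| + |(k : ℝ)|)) := by ring
  rw [h3]
  have hX : 0 ≤ 18 * C * ((q : ℝ) ^ 3 * (1 + |(j : ℝ)| + |(k : ℝ)|)) := by positivity
  calc 18 * C * ((q : ℝ) ^ 3 * (1 + |(j : ℝ)| + |(k : ℝ)|)) * (|s.im + thetaOf χ j k| + 4)
      ≤ 18 * C * ((q : ℝ) ^ 3 * (1 + |(j : ℝ)| + |(k : ℝ)|)) * ((|s.im| + 4) * (D * (|(j : ℝ)| + |(k : ℝ)| + 2))) := by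
        refine mul_le_mul_of_nonneg_left (h1.trans ?_) hX
        exact mul_le_mul_of_nonneg_left h2 (by positivity)
    _ ≤ 18 * (C + 1) * D * ((q : ℝ) ^ 3 * (|(j : ℝ)| + |(k : ℝ)| + 2) ^ 2) * (|s.im| + 4) := by
        have h4 : 1 + |(j : ℝ)| + |(k : ℝ)| ≤ |(j : ℝ)| + |(k : ℝ)| + 2 := by linarith
        have h5 : 0 ≤ |s.im| + 4 := by positivity
        nlinarith [mul_nonneg (mul_nonneg (by positivity : (0 : ℝ) ≤ (q : ℝ) ^ 3) h5) (by positivity : 0 ≤ D),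
          mul_nonneg hX h5]

end ZFRFields
end Literature.NumberTheory.Sieve.CubicSieve
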